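import Literature.AlgebraicGeometry.AbelianSchemes.RoofTranslateComposite               -- ★ (C5a) p850041: roof currency, §1 bookkeeping, descent of `[p]` through `c`, and its ★ imports
import Literature.AlgebraicGeometry.AbelianSchemes.RoofTargetUnique                     -- ★ (TW) `roof_target_unique`
import Literature.AlgebraicGeometry.GroupSchemes.EtaleKernelDecidedOnPoints              -- ★ `comp_eq_one_iff_of_forall_points_of_charZero`
import Literature.AlgebraicGeometry.AbelianSchemes.IsogenyOfFiniteKernelOnPoints          -- ★ `isFinite_left_of_surjective_of_finite_setOf_map_eq_one`, `finite_setOf_map_eq_one_of_pow_eq_one`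
import Literature.AlgebraicGeometry.AbelianSchemes.RoofImageLineCount                     -- ★ p850779 `map_pt_mul'`, `map_pt_inv'` (points of a homomorphism)
import Mathlib.GroupTheory.OrderOfElement
import HarnessLib

/-!
# TWO COVER LEGS INTO ONE STRUCTURED MIDDLE: `A₁ —c₁→ B ←c₂— A₂` with `Ker cᵢ = Aᵢ[𝔭]`, `cᵢ^*λ_B = p·λᵢ`, common intertwiners and matching level points
# ⟹ a STRUCTURED ISOMORPHISM `f : A₁ ⥲ A₂` (`f ≫ c₂ = c₁`, `f^*λ₂ = λ₁`, `ι₁(a) ≫ f = f ≫ ι₂(a)`, `f(σ₁ᵃ) = σ₂ᵃ`) ([MumfordAV1970] §7 Thm. 4, §15 Thm. 1, §23)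

Topic `AlgebraicGeometry/AbelianSchemes`, namespace `Literature.AlgebraicGeometry.AbelianSchemes.AbelianSchemeOver`.  THEOREMS ONLY (no definition, no named fact,
no `instance`, no notation, no `sorry`).  Cell `hodgecm-mathlib` (D-0151), F0∕P6 «MOD», line L2 (socket `stub_SPEC`), organ **(U)** «ROOF-TARGET POINT UNIQUENESS UPSTAIRS»
of (HC2-img) (LA2-plan (g2) deal 2026-09-02T08:56:42Z (2), φ♭-ROAD 09:18:21Z → B-p08 (g35)): the generic ENGINE.  `--supports stmt-HodgeConjecture-24832`, count-neutral.
HONEST LABEL: HC_CM is proved only modulo the cell's 2 remaining named inputs (hLiu418 24832, h413 24833) until rung 0 closes; this file is generic and discharges none.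

## Mathematics (`Ω = Ω̄` of characteristic `0`; pairing-free)

Two isogeny roofs `A —q→ B ←c₁— A₁`, `A —q′→ B′ ←c₂— A₂` off ONE structured source through ONE kernel share the middle (★ `roof_target_unique`: `B ≅ B′` under `A`, exact on
`λ_B`, `b_a`, level points; ★ `roof_leg_transport_along_target_iso`), so one is left with TWO COVER LEGS `c₁ : A₁ → B`, `c₂ : A₂ → B` INTO ONE MIDDLE with (r2) `Ker cᵢ(Ω) =
Aᵢ[𝔭](Ω)`, `cᵢ` surjective, (r3) `cᵢ ≫ λ_B ≫ cᵢ^∨ = λᵢ ≫ [p]` (`p ∈ 𝔭`), (r4) `ιᵢ(a) ≫ cᵢ = cᵢ ≫ b_a` for ONE family `b_a` of endomorphisms of `B`, (r5) `c₁(σ₁ʲ) = c₂(σ₂ʲ)`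
for two families of `N`-torsion points with `p ∤ N`.  THEN `A₁ ≅ A₂` AS STRUCTURED OBJECTS:
* RETURN MAPS.  `[p]_{Aᵢ}` kills `Ker cᵢ ⊆ Aᵢ[p]` on all `T`-points (★ KER-EQ), so it DESCENDS through the fppf `cᵢ`: `cᵢ ≫ dᵢ = [p]` for a homomorphism `dᵢ : B → Aᵢ`
  (★ `existsUnique_comp_eq_of_forall_comp_eq_one`), with `dᵢ ≫ cᵢ = [p]_B`, `b_a ≫ dᵢ = dᵢ ≫ ιᵢ(a)` (cancel `cᵢ`), `dᵢ ≫ λᵢ ≫ dᵢ^∨ = λ_B ≫ [p]` (cancel `cᵢ` left,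
  `cᵢ^∨` right: `cᵢ^∨ ≫ dᵢ^∨ = [p]`), `dᵢ` surjective and finite (its kernel points are `p`-torsion).
* SAME KERNEL.  With `(p) = 𝔭𝔮`: `Ker dᵢ(Ω) = {β | b(𝔮) β = 1}` — lift `β = cᵢ(x)`; `dᵢ β = x^p`, and `x^p = 1 ⟺ ιᵢ(𝔭𝔮) x = 1 ⟺ ∀ u ∈ 𝔮, cᵢ(ιᵢ(u) x) = b_u β = 1` —
  INDEPENDENT OF `i`; hence equal kernels on all `T`-points (★ `comp_eq_one_iff_of_forall_points_of_charZero`, étale kernels in characteristic `0`).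
* ★ `roof_target_unique` for `(d₁, d₂)` out of `B` (same kernel, (r3) rows `dᵢ ≫ λᵢ ≫ dᵢ^∨ = λ_B ≫ [p]`): an isomorphism `f : A₁ ⥲ A₂`, a homomorphism, `d₁ ≫ f = d₂`,
  EXACT on the polarisations (`f ≫ λ₂ ≫ f^∨ = λ₁`) and intertwining `ι₁(a)`, `ι₂(a)` (both intertwined with `b_a` by `d₁`, `d₂`).
* `f ≫ c₂ = c₁` (cancel the epimorphism `d₁`: `d₁ ≫ f ≫ c₂ = d₂ ≫ c₂ = [p] = d₁ ≫ c₁`), so `c₂(f(σ₁ʲ)) = c₁(σ₁ʲ) = c₂(σ₂ʲ)`: the quotient `f(σ₁ʲ)·(σ₂ʲ)⁻¹` lies in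
  `Ker c₂(Ω) = A₂[𝔭] ⊆ A₂[p]` and is `N`-torsion, `gcd(p, N) = 1`, so `f(σ₁ʲ) = σ₂ʲ`.
For the P6a moduli datum (`RoofΩ`, cover ideal `𝔭_w`): two roofs `RoofΩ … y t₁ K`, `RoofΩ … y t₂ K` give such legs, `f` is an isomorphism of the generic tuples at
`t₁`, `t₂` (★ `exists_tupleRel_baseChange_comp_of_iso_of_points`), and (L1) `injΩ` yields `t₁ = t₂` (the Lines-side head, B-p08 (g35) §J.2).

## Contents
* §1 **`exists_returnHom_of_cover`** — the return map `d` of ONE cover leg with all its rows (descent, `d ≫ c = [p]`, intertwining, similitude, surjective, finite, kernel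
  on `Ω`-points `= B[b(𝔮)]`).
* §2 **`exists_iso_of_two_covers`** — THE HEAD.

## References
* [MumfordAV1970] D. Mumford, *Abelian Varieties* (1970), §7 Thm. 4 (p. 72), §15 Thm. 1 (p. 143), §19 Thm. 3 (p. 176), §23 Thm. 2 (p. 231).
* [MumfordFogartyKirwan1994] D. Mumford, J. Fogarty, F. Kirwan, *Geometric Invariant Theory*, 3rd ed. (1994), Ch. 7 §2 Def. 7.2 (p. 129), Def. 7.3 (p. 130).
* [Liu2021] Y. Liu, *Fourier–Jacobi cycles and arithmetic relative trace formula*, Camb. J. Math. 9 (2021), App. D, Prop. D.8 (p. 135).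
* [Milne2005ShimuraVarieties] J. S. Milne, *Introduction to Shimura varieties* (2005), §14 pp. 124–125.
-/

set_option autoImplicit false

noncomputable section

-- Mathlib's `Over`/pull-back API and the ★ points readers are stated across semireducible wrappers (as in the ★ `AbelianSchemes/*` files).
set_option backward.isDefEq.respectTransparency false

open CategoryTheory CategoryTheory.Limits AlgebraicGeometry MonoidalCategory CartesianMonoidalCategory
open scoped MonObj CategoryTheory.Obj NumberField Pointwise
open IsDedekindDomain NumberField
open Literature.AlgebraicGeometry.Motives (AlgPoints SchemeOver specOver)

namespace Literature.AlgebraicGeometry.AbelianSchemes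

namespace AbelianSchemeOver

/-! ## §1 The return map of one cover leg -/

section OneLeg

variable {F : Type} [Field F] [NumberField F]
  {Ω : Type} [Field Ω] [IsAlgClosed Ω] [CharZero Ω]
  {A'' B : AbelianSchemeOver (Spec (.of Ω))}
  (act'' : A''.RingAction (𝓞 F))
  (D'' : A''.DualPair) (pol'' : A''.Polarization D'')
  (DB : B.DualPair) (lamB : B.X ⟶ DB.hat.X)
  (c : A''.X ⟶ B.X) [IsMonHom c]

set_option maxHeartbeats 400000 in
/-- **THE RETURN MAP OF A COVER LEG.**  Over `Ω = Ω̄` of characteristic `0`: a surjective homomorphism `c : A″ → B` with (r2) `Ker c(Ω) = A″[𝔭](Ω)`, (r3) `c ≫ λ_B ≫ c^∨ =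
λ″ ≫ [p]`, (r4) `ι″(a) ≫ c = c ≫ b_a`; `𝔭 ≠ 0`, `(p) = 𝔭𝔮`, `p ≠ 0`.  THEN there is a homomorphism `d : B → A″` with `c ≫ d = [p]`, `d ≫ c = [p]`, `b_a ≫ d = d ≫ ι″(a)`,
`d ≫ λ″ ≫ d^∨ = λ_B ≫ [p]`, `d` surjective and finite, and `Ker d(Ω) = {β | ∀ u ∈ 𝔮, b_u β = 1}`.  (Steps 1–3 and 6 of ★ (C5a) `exists_translComposite_of_roof`, with the
`q`-leg removed.) [cite: MumfordAV1970, §7 Thm. 4 (p. 72), §15 Thm. 1 (p. 143), §23 (p. 231)] [cite: Liu2021, Prop. D.8 (p. 135)] -/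
theorem exists_returnHom_of_cover
    (𝔭 𝔮 : Ideal (𝓞 F)) (h𝔭 : 𝔭 ≠ ⊥) {p : ℕ} (hp : p ≠ 0) (hpq : 𝔭 * 𝔮 = Ideal.span {(p : 𝓞 F)})
    (hDB : Nonempty ((Scheme.Modules.pullback DB.unitHatSlice).obj DB.P ≅ SheafOfModules.unit _))
    (h2 : ∀ P : A''.toAffine.toAbelianVariety.Points Ω,
      (AlgPoints.map c P : B.toAffine.toAbelianVariety.Points Ω) = 1 ↔
        ∀ a ∈ 𝔭, (AlgPoints.map (act''.i a) P : A''.toAffine.toAbelianVariety.Points Ω) = 1)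
    (h2s : Function.Surjective c.left.base)
    (h3'' : c ≫ lamB ≫ DualPair.dualIsogenyOver c D'' DB = pol''.lam ≫ D''.hat.mulN p)
    (b : 𝓞 F → (B.X ⟶ B.X)) (h4 : ∀ a : 𝓞 F, act''.i a ≫ c = c ≫ b a) :
    ∃ (d : B.X ⟶ A''.X) (_ : IsMonHom d),
      c ≫ d = A''.mulN p ∧ d ≫ c = B.mulN p ∧
      (∀ a : 𝓞 F, b a ≫ d = d ≫ act''.i a) ∧
      d ≫ pol''.lam ≫ DualPair.dualIsogenyOver d DB D'' = lamB ≫ DB.hat.mulN p ∧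
      Surjective d.left ∧ IsFinite d.left ∧
      ∀ β : B.toAffine.toAbelianVariety.Points Ω,
        (AlgPoints.map d β : A''.toAffine.toAbelianVariety.Points Ω) = 1 ↔
          ∀ u ∈ 𝔮, (AlgPoints.map (b u) β : B.toAffine.toAbelianVariety.Points Ω) = 1 := by
  classical
  -- ===================== 0. INSTANCES =====================
  haveI : IsCommMonObj A''.X := A''.isCommMonObj_of_isReduced_base
  haveI : IsCommMonObj B.X := B.isCommMonObj_of_isReduced_base
  haveI hpol'' := pol''.isMonHom
  have hD'' := pol''.nonempty_unitHatSlice_iso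
  haveI hcd : IsMonHom (DualPair.dualIsogenyOver c D'' DB) := DualPair.isMonHom_dualIsogenyOver c D'' DB hDB hD''
  haveI : Surjective c.left := ⟨h2s⟩
  haveI : IsMonHom (A''.mulN p) := A''.isMonHom_mulN p
  haveI : IsMonHom (B.mulN p) := B.isMonHom_mulN p
  haveI : LocallyOfFiniteType A''.X.hom := (inferInstance : LocallyOfFiniteType A''.toAffine.toAbelianVariety.X.hom)
  have hp𝔭𝔮 : (p : 𝓞 F) ∈ 𝔭 * 𝔮 := hpq ▸ Ideal.mem_span_singleton_self _
  have hp𝔭 : (p : 𝓞 F) ∈ 𝔭 := Ideal.mul_le_right hp𝔭𝔮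
  -- ===================== 1. THE LEG `c`: kernel `A″[𝔭]` on ALL `T`-points, finite, flat =====================
  obtain ⟨m, E, hE, Pm, Qm, N, hN, hP, hQ, hQP, hPQ, hspan, -, -⟩ :=
    Literature.NumberTheory.NumberFields.SerrePresentation.exists_serrePresentation_of_ideal 𝔭 h𝔭
  have hN𝔭 : ((N : ℕ) : 𝓞 F) ∈ 𝔭 := natCast_mem_of_quasiInverse Pm Qm hQP hspan
  have hkerc : ∀ ⦃T : Over (Spec (.of Ω))⦄ (t : T ⟶ A''.X), t ≫ c = 1 ↔ ∀ a ∈ 𝔭, t ≫ act''.i a = 1 :=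
    fun T t => comp_eq_one_iff_forall_mem_of_forall_points_of_charZero act'' E hE Pm Qm c hN hP hQ hQP hPQ hspan h2 t
  haveI hcfin : IsFinite c.left := isFinite_left_of_surjective_of_forall_points act'' c hN hN𝔭 (fun Pt hPt => (h2 Pt).1 hPt)
  haveI hcflat : Flat c.left := flat_left_of_isFinite_of_surjective c
  -- ===================== 2. THE DESCENT `d : B → A″` OF `[p]_{A″}` THROUGH `c` =====================
  have hker_p : ∀ ⦃T : Over (Spec (.of Ω))⦄ (t : T ⟶ A''.X), t ≫ c = 1 → t ≫ A''.mulN p = 1 := fun T t ht => by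
    have h := (hkerc t).1 ht (p : 𝓞 F) hp𝔭
    rw [comp_i_natCast] at h
    rw [mulN_def, MonObj.comp_pow, Category.comp_id]
    exact h
  obtain ⟨d, hcd_p, -⟩ := A''.existsUnique_comp_eq_of_forall_comp_eq_one c (A''.mulN p) hker_p
  haveI hdmon : IsMonHom d := A''.isMonHom_of_comp_eq c (A''.mulN p) hcd_p
  have hdc_p : d ≫ c = B.mulN p := by
    apply A''.cancel_left_of_flat_surjective c
    rw [← Category.assoc, hcd_p, mulN_def, mulN_def]
    exact (A''.comp_pow_id_eq_pow_id_comp c p).symm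
  have hcd_dual : DualPair.dualIsogenyOver c D'' DB ≫ DualPair.dualIsogenyOver d DB D'' = (𝟙 DB.hat.X) ^ p := by
    rw [← DualPair.dualIsogenyOver_comp d c DB D'' DB, DualPair.dualIsogenyOver_congr DB DB (h₂ := B.isMonHom_mulN p) hdc_p,
      DB.dualIsogenyOver_mulN hDB p, mulN_def]
  haveI hdd : IsMonHom (DualPair.dualIsogenyOver d DB D'') := DualPair.isMonHom_dualIsogenyOver d DB D'' hD'' hDB
  -- `b_a ≫ d = d ≫ ι″(a)` (cancel the epimorphism `c`)
  have hbd : ∀ a : 𝓞 F, b a ≫ d = d ≫ act''.i a := fun a => by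
    haveI := act''.isMonHom a
    apply A''.cancel_left_of_flat_surjective c
    rw [← Category.assoc, ← h4, Category.assoc, hcd_p, ← Category.assoc, hcd_p, mulN_def]
    exact (A''.comp_pow_id_eq_pow_id_comp (act''.i a) p)
  -- ===================== 3. `d` SURJECTIVE and FINITE =====================
  haveI : Surjective (A''.mulN p).left := A''.surjective_pow_id_left_of_ne_zero hp
  have hds : Function.Surjective d.left.base := by
    have h : Function.Surjective ((A''.mulN p).left).base := (inferInstance : Surjective (A''.mulN p).left).1
    rw [← hcd_p, Over.comp_left, Scheme.Hom.comp_base] at h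
    exact Function.Surjective.of_comp h
  haveI hdsurj : Surjective d.left := ⟨hds⟩
  have hdfin : IsFinite d.left := by
    refine isFinite_left_of_surjective_of_finite_setOf_map_eq_one d (finite_setOf_map_eq_one_of_pow_eq_one d p hp fun β hβ => ?_)
    -- `β^p = c(d β) = 1`
    change (β : specOver Ω Ω ⟶ B.X) ≫ d = 1 at hβ
    have h : (β : specOver Ω Ω ⟶ B.X) ≫ (d ≫ c) = 1 := by rw [← Category.assoc, hβ, MonObj.one_comp]
    have h' : (β : specOver Ω Ω ⟶ B.X) ≫ (d ≫ c) = β ^ p := by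
      rw [hdc_p, mulN_def, MonObj.comp_pow]
      exact congrArg (· ^ p) (Category.comp_id _)
    exact h'.symm.trans h
  -- ===================== 4. SIMILITUDE `d ≫ λ″ ≫ d^∨ = λ_B ≫ [p]` =====================
  have hlam'' : A''.mulN p ≫ pol''.lam = pol''.lam ≫ D''.hat.mulN p := by
    rw [mulN_def, mulN_def]; exact (A''.comp_pow_id_eq_pow_id_comp pol''.lam p).symm
  have key : d ≫ pol''.lam ≫ DualPair.dualIsogenyOver d DB D'' = lamB ≫ DB.hat.mulN p := by
    apply A''.cancel_left_of_flat_surjective c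
    calc c ≫ d ≫ pol''.lam ≫ DualPair.dualIsogenyOver d DB D''
        = (c ≫ d) ≫ pol''.lam ≫ DualPair.dualIsogenyOver d DB D'' := by rw [Category.assoc]
      _ = (pol''.lam ≫ D''.hat.mulN p) ≫ DualPair.dualIsogenyOver d DB D'' := by rw [hcd_p, ← Category.assoc, hlam'']
      _ = (c ≫ lamB ≫ DualPair.dualIsogenyOver c D'' DB) ≫ DualPair.dualIsogenyOver d DB D'' := by rw [h3'']
      _ = c ≫ lamB ≫ DB.hat.mulN p := by
          simp only [Category.assoc]; rw [hcd_dual, mulN_def]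
  -- ===================== 5. KERNEL OF `d` ON `Ω`-POINTS: `B[b(𝔮)]` =====================
  have hcΩ : Function.Surjective (AlgPoints.map (L := Ω) c) := AlgPoints.map_surjective_of_surjective_of_isAlgClosed' c
  have hkerd : ∀ β : B.toAffine.toAbelianVariety.Points Ω,
      (AlgPoints.map d β : A''.toAffine.toAbelianVariety.Points Ω) = 1 ↔
        ∀ u ∈ 𝔮, (AlgPoints.map (b u) β : B.toAffine.toAbelianVariety.Points Ω) = 1 := by
    intro β
    obtain ⟨a'', ha''⟩ := hcΩ β
    rw [AlgPoints.map_apply] at ha''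
    -- `β ≫ d = a″ ≫ c ≫ d = a″ ≫ ι″(p)`
    have hdβ : ((β : specOver Ω Ω ⟶ B.X) ≫ d) = a'' ≫ act''.i (p : 𝓞 F) := by
      rw [← ha'', Category.assoc, hcd_p, comp_i_natCast, mulN_def, MonObj.comp_pow, Category.comp_id]
    -- `(a″ ≫ ι″ u) ≫ c = β ≫ b u`
    have hZ : ∀ u : 𝓞 F, (a'' ≫ act''.i u) ≫ c = (β : specOver Ω Ω ⟶ B.X) ≫ b u := fun u => by
      rw [Category.assoc, h4 u, ← Category.assoc, ha'']
    show ((β : specOver Ω Ω ⟶ B.X) ≫ d = 1) ↔ ∀ u ∈ 𝔮, (β : specOver Ω Ω ⟶ B.X) ≫ b u = 1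
    rw [hdβ]
    constructor
    · intro hx
      -- `a″` killed by `(p) = 𝔭𝔮`
      have hx' : ∀ mm ∈ 𝔭 * 𝔮, a'' ≫ act''.i mm = 1 := by
        rw [hpq]
        refine forall_mem_span_natCast_of_pow_eq_one act'' a'' ?_
        rw [← comp_i_natCast act'' a'' p]; exact hx
      intro u hu
      rw [← hZ u, hkerc]
      exact forall_mem_comp_i_comp_i_eq_one act'' a'' hx' (I := 𝔮) (J := 𝔭) (by rw [mul_comm]) hu
    · intro hx
      have hu : ∀ u ∈ 𝔮, ∀ b' ∈ 𝔭, (a'' ≫ act''.i u) ≫ act''.i b' = 1 := fun u hu => by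
        rw [← hkerc, hZ u]
        exact hx u hu
      have h := forall_mem_mul_of_forall_forall act'' a'' hu
      rw [mul_comm, hpq] at h
      exact h (p : 𝓞 F) (Ideal.mem_span_singleton_self _)
  exact ⟨d, hdmon, hcd_p, hdc_p, hbd, key, hdsurj, hdfin, hkerd⟩

end OneLeg

/-! ## §2 Two cover legs into one middle: the structured isomorphism of the sources -/

section TwoLegs

variable {F : Type} [Field F] [NumberField F]
  {Ω : Type} [Field Ω] [IsAlgClosed Ω] [CharZero Ω]
  {A₁ A₂ B : AbelianSchemeOver (Spec (.of Ω))}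
  (act₁ : A₁.RingAction (𝓞 F)) (act₂ : A₂.RingAction (𝓞 F))
  (D₁ : A₁.DualPair) (pol₁ : A₁.Polarization D₁) (D₂ : A₂.DualPair) (pol₂ : A₂.Polarization D₂)
  (DB : B.DualPair) (lamB : B.X ⟶ DB.hat.X)
  (c₁ : A₁.X ⟶ B.X) [IsMonHom c₁] (c₂ : A₂.X ⟶ B.X) [IsMonHom c₂]

set_option maxHeartbeats 400000 in
/-- **TWO COVER LEGS INTO ONE STRUCTURED MIDDLE GIVE A STRUCTURED ISOMORPHISM OF THE SOURCES.**  Over `Ω = Ω̄` of characteristic `0`: surjective homomorphisms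
`c₁ : A₁ → B`, `c₂ : A₂ → B` with (r2) `Ker cᵢ(Ω) = Aᵢ[𝔭](Ω)`, (r3) `cᵢ ≫ λ_B ≫ cᵢ^∨ = λᵢ ≫ [p]`, (r4) `ιᵢ(a) ≫ cᵢ = cᵢ ≫ b_a` for ONE family `b`, (r5) `c₁(σ₁ʲ) =
c₂(σ₂ʲ)` for `N`-torsion families `σ₁`, `σ₂`; `𝔭 ≠ 0`, `0 ≠ p ∈ 𝔭`, `gcd(p, N) = 1`.  THEN there is an isomorphism `f : A₁ ⥲ A₂` over `Spec Ω`, a homomorphism, with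
`f ≫ c₂ = c₁`, `f ≫ λ₂ ≫ f^∨ = λ₁` (★ `dualIsogenyOver`), `ι₁(a) ≫ f = f ≫ ι₂(a)` and `f(σ₁ʲ) = σ₂ʲ`.  (★ `roof_target_unique` applied to the two RETURN MAPS
`dᵢ : B → Aᵢ` of §1, which have the same kernel `B[b(𝔮)]`; then `f ≫ c₂ = c₁` by cancelling `d₁`, and the level points by `gcd(p, N) = 1`.)
[cite: MumfordAV1970, §7 Thm. 4 (p. 72), §15 Thm. 1 (p. 143), §23 Thm. 2 (p. 231)] [cite: MumfordFogartyKirwan1994, Ch. 7 §2 Definition 7.2 (p. 129)]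
[cite: Milne2005ShimuraVarieties, §14 pp. 124–125] -/
theorem exists_iso_of_two_covers
    (𝔭 : Ideal (𝓞 F)) (h𝔭 : 𝔭 ≠ ⊥) {p : ℕ} (hp : p ≠ 0) (hp𝔭 : (p : 𝓞 F) ∈ 𝔭)
    (hDB : Nonempty ((Scheme.Modules.pullback DB.unitHatSlice).obj DB.P ≅ SheafOfModules.unit _))
    (h2₁ : ∀ P : A₁.toAffine.toAbelianVariety.Points Ω,
      (AlgPoints.map c₁ P : B.toAffine.toAbelianVariety.Points Ω) = 1 ↔
        ∀ a ∈ 𝔭, (AlgPoints.map (act₁.i a) P : A₁.toAffine.toAbelianVariety.Points Ω) = 1)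
    (h2s₁ : Function.Surjective c₁.left.base)
    (h2₂ : ∀ P : A₂.toAffine.toAbelianVariety.Points Ω,
      (AlgPoints.map c₂ P : B.toAffine.toAbelianVariety.Points Ω) = 1 ↔
        ∀ a ∈ 𝔭, (AlgPoints.map (act₂.i a) P : A₂.toAffine.toAbelianVariety.Points Ω) = 1)
    (h2s₂ : Function.Surjective c₂.left.base)
    (h3₁ : c₁ ≫ lamB ≫ DualPair.dualIsogenyOver c₁ D₁ DB = pol₁.lam ≫ D₁.hat.mulN p)
    (h3₂ : c₂ ≫ lamB ≫ DualPair.dualIsogenyOver c₂ D₂ DB = pol₂.lam ≫ D₂.hat.mulN p)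
    (b : 𝓞 F → (B.X ⟶ B.X)) (h4₁ : ∀ a : 𝓞 F, act₁.i a ≫ c₁ = c₁ ≫ b a) (h4₂ : ∀ a : 𝓞 F, act₂.i a ≫ c₂ = c₂ ≫ b a)
    {J : Type} (σ₁ : J → A₁.toAffine.toAbelianVariety.Points Ω) (σ₂ : J → A₂.toAffine.toAbelianVariety.Points Ω)
    (h5 : ∀ j, (AlgPoints.map c₁ (σ₁ j) : B.toAffine.toAbelianVariety.Points Ω) = AlgPoints.map c₂ (σ₂ j))
    {N : ℕ} (hσ₁ : ∀ j, σ₁ j ^ N = 1) (hσ₂ : ∀ j, σ₂ j ^ N = 1) (hpN : p.Coprime N) :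
    ∃ (f : A₁.X ≅ A₂.X) (_ : IsMonHom f.hom),
      f.hom ≫ c₂ = c₁ ∧
      f.hom ≫ pol₂.lam ≫ DualPair.dualIsogenyOver f.hom D₁ D₂ = pol₁.lam ∧
      (∀ a : 𝓞 F, act₁.i a ≫ f.hom = f.hom ≫ act₂.i a) ∧
      ∀ j, (AlgPoints.map f.hom (σ₁ j) : A₂.toAffine.toAbelianVariety.Points Ω) = σ₂ j := by
  classical
  haveI : IsCommMonObj A₁.X := A₁.isCommMonObj_of_isReduced_base
  haveI : IsCommMonObj A₂.X := A₂.isCommMonObj_of_isReduced_base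
  haveI : IsCommMonObj B.X := B.isCommMonObj_of_isReduced_base
  haveI hpol₁ := pol₁.isMonHom
  haveI hpol₂ := pol₂.isMonHom
  have hD₁ := pol₁.nonempty_unitHatSlice_iso
  have hD₂ := pol₂.nonempty_unitHatSlice_iso
  -- `(p) = 𝔭𝔮`
  obtain ⟨𝔮, hpq⟩ : 𝔭 ∣ Ideal.span {(p : 𝓞 F)} := Ideal.dvd_iff_le.mpr ((Ideal.span_singleton_le_iff_mem _).mpr hp𝔭)
  -- the two return maps
  obtain ⟨d₁, hd₁mon, hcd₁, hdc₁, hbd₁, key₁, hd₁s, hd₁f, hkerd₁⟩ :=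
    exists_returnHom_of_cover act₁ D₁ pol₁ DB lamB c₁ 𝔭 𝔮 h𝔭 hp hpq.symm hDB h2₁ h2s₁ h3₁ b h4₁
  obtain ⟨d₂, hd₂mon, hcd₂, hdc₂, hbd₂, key₂, hd₂s, hd₂f, hkerd₂⟩ :=
    exists_returnHom_of_cover act₂ D₂ pol₂ DB lamB c₂ 𝔭 𝔮 h𝔭 hp hpq.symm hDB h2₂ h2s₂ h3₂ b h4₂
  haveI := hd₁mon; haveI := hd₂mon; haveI := hd₁s; haveI := hd₂s; haveI := hd₁f; haveI := hd₂f
  -- same kernel on all `T`-points (étale kernels decided on `Ω`-points)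
  have hker : ∀ ⦃T : Over (Spec (.of Ω))⦄ (t : T ⟶ B.X), t ≫ d₁ = 1 ↔ t ≫ d₂ = 1 :=
    comp_eq_one_iff_of_forall_points_of_charZero d₁ d₂ fun β => (hkerd₁ β).trans (hkerd₂ β).symm
  -- ★ roof-target uniqueness for `(d₁, d₂)` out of `B`
  obtain ⟨f, hfmon, hdf, -, hflam, hfend, -⟩ :=
    roof_target_unique DB D₁ D₂ hD₁ hD₂ lamB pol₁.lam pol₂.lam d₁ d₂ p hker key₁ key₂
  haveI := hfmon
  -- `f ≫ c₂ = c₁` (cancel the epimorphism `d₁`)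
  haveI : Flat d₁.left := flat_left_of_isFinite_of_surjective d₁
  have hfc : f.hom ≫ c₂ = c₁ := by
    apply B.cancel_left_of_flat_surjective d₁
    rw [← Category.assoc, hdf, hdc₂, hdc₁]
  refine ⟨f, hfmon, hfc, hflam, fun a => hfend (b a) (act₁.i a) (act₂.i a) (hbd₁ a) (hbd₂ a), fun j => ?_⟩
  -- level points: `z := f(σ₁ʲ) · (σ₂ʲ)⁻¹ ∈ Ker c₂(Ω) ⊆ A₂[p]`, `z^N = 1`, `gcd(p, N) = 1`
  have hmapc : ∀ P : A₁.toAffine.toAbelianVariety.Points Ω,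
      (AlgPoints.map c₂ (AlgPoints.map f.hom P : A₂.toAffine.toAbelianVariety.Points Ω) : B.toAffine.toAbelianVariety.Points Ω) =
        AlgPoints.map c₁ P := fun P => by
    rw [← AlgPoints.map_comp_apply, hfc]
  set z : A₂.toAffine.toAbelianVariety.Points Ω :=
    (AlgPoints.map f.hom (σ₁ j) : A₂.toAffine.toAbelianVariety.Points Ω) * (σ₂ j)⁻¹ with hzdef
  have hz_c : (AlgPoints.map c₂ z : B.toAffine.toAbelianVariety.Points Ω) = 1 := by
    rw [hzdef, map_pt_mul', map_pt_inv', hmapc, h5 j, mul_inv_cancel]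
  have hz_p : z ^ p = 1 := by
    have h : (z : specOver Ω Ω ⟶ A₂.X) ≫ act₂.i (p : 𝓞 F) = 1 := (h2₂ z).1 hz_c (p : 𝓞 F) hp𝔭
    rw [comp_i_natCast] at h
    exact h
  have hfN : (AlgPoints.map f.hom (σ₁ j) : A₂.toAffine.toAbelianVariety.Points Ω) ^ N = 1 := by
    have h : ((σ₁ j : specOver Ω Ω ⟶ A₁.X) ^ N) ≫ f.hom = 1 := by
      rw [show (σ₁ j : specOver Ω Ω ⟶ A₁.X) ^ N = 1 from hσ₁ j, MonObj.one_comp]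
    rw [MonObj.pow_comp] at h
    exact h
  have hz_N : z ^ N = 1 := by
    rw [hzdef, mul_pow, inv_pow, hfN, hσ₂ j, inv_one, mul_one]
  have hz : z = 1 := by
    have ho : orderOf z ∣ Nat.gcd p N := Nat.dvd_gcd (orderOf_dvd_of_pow_eq_one hz_p) (orderOf_dvd_of_pow_eq_one hz_N)
    rw [hpN, Nat.dvd_one] at ho
    exact orderOf_eq_one_iff.mp ho
  exact mul_inv_eq_one.mp hz

end TwoLegs

end AbelianSchemeOver

end Literature.AlgebraicGeometry.AbelianSchemes

end
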